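import Summits.HodgeConjecture.HodgeConjecture.Theorems.EquidimHeckeLinkedAtLift            -- ★ (A4) `heckeLinked_at_lift`, `heckeLinked_at_ellAdicMove` (and their ★ imports)
import Literature.AlgebraicGeometry.ModuliOfAbelianVarieties.SiegelHeckeLinkDegree              -- (E-a) DEF `HeckeLinkedDeg` (B-p14 (g14))
import HarnessLib

/-!
# E-road, Hecke-link brick (A4) WITH ITS DEGREE: `HeckeLinkedDeg` at the lifted point

Cell hodgecm-mathlib, seat B-p18 (g17); B-plan1 (g15) rulings 2026-08-29 23:17:31Z / 23:19:57Z (socket (B) text v7,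
package (E-b)); companion of ★ `Theorems/EquidimHeckeLinkedAtLift` (B-p13 (g16)).  PROOF lane (`--as helper`): theorems only.
TEXT OF RECORD = (E-a) `SiegelHeckeLinkDegree` (B-p14 (g14)): `HeckeLinkedDeg 𝓜 𝓜′ r′ y x ν` is ★ `HeckeLinked 𝓜 𝓜′ r′ y x`
VERBATIM with ONE extra conjunct `ᵗγ E_δ γ = ν • E_{δ′}` recording the similitude factor (the DEGREE) of the lattice map `γ`.

## Why a second file

★ `HeckeLinked` hides `γ` behind `∃`, and with it the multiplier: (QA3) of ★ `QuotientAdapted` only says `∃ ν : ℚ, 0 < ν ∧ …`,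
and `QuotientAdapted δ δ N (N·m) r r′ γ` does NOT force `ν = m` (e.g. `γ = 1`, `ν = 1` is quotient-adapted at `(N, N·m)` for
every `m`).  The algebraic isogeny-quotient side of socket (B) lives at the level `N′ = N·ν` (B-plan1 (g15) 23:19:57Z: «the
DEGREE of the link is part of the datum»), so the producers must EXPORT the degree they have in hand.  They do have it: the
`ℓ`-adic move ★ `exists_ellAdicMove_integral` (`SiegelEllAdicHeckeMove`) delivers `ᵗγ E_δ γ = ℓᴷ • E_δ` with the SAME `K` as the
lifted level `N′ = N·ℓᴷ`.  This file re-runs ★ (A4) keeping that clause: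

* `heckeLinkedDeg_at_lift` — ★ `heckeLinked_at_lift` with a binder `(ν : ℕ) (hsimν : ᵗγ E_δ γ = (ν : ℚ) • E_δ)` threaded into the
  anonymous constructor (proof = ★ :85–:120 verbatim, one token added);
* `heckeLinkedDeg_at_ellAdicMove` — ★ `heckeLinked_at_ellAdicMove` with conclusion `HeckeLinkedDeg 𝓜 𝓜′ (r·u) y x (ℓ ^ K)`
  (proof = ★ :155–:190 verbatim; `hsim` re-cast along `Nat.cast_pow`);
* `heckeLinkedDeg_at_ellAdicMove'` — the same with a level VARIABLE `N′ = N·ℓᴷ` (tower typing: `SiegelLevel.N` is opaque, never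
  syntactically a product; shape of ★ `EquidimSocketThickLinkedLift.heckeLinked_at_ellAdicMove'`);
* `exists_heckeLinkedDeg_at_ellAdicMove_of_changeLevel` — ★ `exists_heckeLinked_at_ellAdicMove_of_changeLevel` with the degree.

The forgetful direction `HeckeLinkedDeg … ν → HeckeLinked …` is B-p14 (g14)'s `Theorems/EquidimHeckeQuotientMapOfLinkedDeg` (E-d);
it is not restated here.  HC_CM is proved only modulo the 7 printed citations until rung 0 closes; this file discharges none of them.

References: [Milne2005ShimuraVarieties, §5 p. 58 (the maps `T(g)`, Def. 5.14), Lemma 5.13 p. 57, §6 Thm. 6.11 pp. 74–75];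
[ShimuraIATAF1971, §3.2 Lemma 3.9]; [Lange2023AbelianVarietiesComplex, §7.1.2 Lemma 7.1.6–7.1.7 (pp. 350–353)];
[Deligne1971TravauxShimura, 4.11–4.12 pp. 148–149].
-/

set_option autoImplicit false

noncomputable section

set_option linter.dupNamespace false

namespace Summit.HodgeConjecture.HodgeConjecture.Theorems.EquidimHeckeLinkDeg

open CategoryTheory AlgebraicGeometry Matrix
open Literature.AlgebraicGeometry
open Literature.AlgebraicGeometry.Motives (SchemeOver ComplexPoints AlgPoints specOver)
open Literature.AlgebraicGeometry.AbelianSchemes (PolarizedAbelianSchemeWithLevel)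
open Literature.AlgebraicGeometry.ModuliOfAbelianVarieties
open SiegelModuli
open Literature.NumberTheory.Automorphic (siegelUpperHalfSpace)
open Literature.NumberTheory.Adeles (latticeOfGL mem_latticeOfGL_one_iff)
open Summit.HodgeConjecture.CorCM.HypDel.UHead (isAdmissibleAt_of_classifyingMap_eq isAdmissibleAt_of_rel)

variable {g N m : ℕ} {δ : Fin g → ℕ}

/-- **(A4) WITH DEGREE — «`HeckeLinkedDeg` at the lifted point».**  ★ `EquidimHeckeLink.heckeLinked_at_lift` with the
similitude factor of the move EXPORTED: let `θ`, `γ` be a rational move (`J(θ Z) = γ_ℝ J(Z) γ_ℝ⁻¹`, `θ` open) with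
`QuotientAdapted δ δ N (N·m) r r′ γ` for principal representatives `r, r′ ∈ K_δ(1)` and `ᵗγ E_δ γ = ν • E_δ` for a GIVEN natural
number `ν`, let `x ∈ 𝓜_N(ℂ)` be classified by a triple `Pₓ` admissible at `(Zₓ, r)`, and let `y ∈ 𝓜_{N·m}(ℂ)` be classified by
a triple `P₀′` admissible at `(Z₀′, r′)` with `θ Z₀′ = Zₓ`.  Then `HeckeLinkedDeg 𝓜 𝓜′ r′ y x ν`: every `(Z, r′)`-admissible
`P′` of class `y` is admissible where `P₀′` is up to `Γ_δ(N·m)` (★ `isAdmissibleAt_of_classifyingMap_eq`, ★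
`exists_siegelLevelGroup_smul_of_isAdmissibleAt`: `Z = M′ • Z₀′`), `θ` carries the `Γ_δ(N·m)`-move to a `Γ_δ(N)`-move
(`θ Z = M • Zₓ`, ★ (L3) `exists_siegelLevelGroup_apply_gDHom_smul`), and `Pₓ` stays admissible along `Γ_δ(N)`-moves at the
principal `r` (★ `rel_iff_exists_smul`, ★ `isAdmissibleAt_of_rel`); the degree conjunct is `hsimν` itself.
[cite: Milne2005ShimuraVarieties, §6 Thm. 6.11 p. 74, p. 70] [cite: ShimuraIATAF1971, §3.2 Lemma 3.9]
[cite: Lange2023AbelianVarietiesComplex, §7.1.2 Lemma 7.1.6–7.1.7 (pp. 350–353)] -/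
theorem heckeLinkedDeg_at_lift (hg : 0 < g) (hδ : IsPolarizationType δ) (hN : 3 ≤ N) (hm : 0 < m)
    (𝓜 : SiegelFineModuliScheme g N δ) (𝓜' : SiegelFineModuliScheme g (N * m) δ)
    [IsLocallyNoetherian (specOver ℚ ℂ).left]
    (θ : siegelUpperHalfSpace g → siegelUpperHalfSpace g) (hθo : IsOpenMap θ) (γ : GL (Fin g ⊕ Fin g) ℚ)
    (hθ : ∀ Z : siegelUpperHalfSpace g, jOfSiegel δ ((θ Z : siegelUpperHalfSpace g) : Matrix (Fin g) (Fin g) ℂ) =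
      conjJ (Matrix.GeneralLinearGroup.map (algebraMap ℚ ℝ) γ) (jOfSiegel δ ((Z : siegelUpperHalfSpace g) : Matrix (Fin g) (Fin g) ℂ)))
    {r r' : gspFinAdelic δ} (hr : r ∈ principalLevelSubgroup δ 1) (hr' : r' ∈ principalLevelSubgroup δ 1)
    (hQA : QuotientAdapted δ δ N (N * m) r r' γ)
    (ν : ℕ) (hsimν : (γ : Matrix (Fin g ⊕ Fin g) (Fin g ⊕ Fin g) ℚ)ᵀ * typeFormOver δ ℚ *
      (γ : Matrix (Fin g ⊕ Fin g) (Fin g ⊕ Fin g) ℚ) = (ν : ℚ) • typeFormOver δ ℚ)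
    {x : ComplexPoints ((Motives.baseChange ℚ ℂ).obj 𝓜.M)} (Zx : siegelUpperHalfSpace g)
    (Px : PolarizedAbelianSchemeWithLevel g N δ (specOver ℚ ℂ).left) (hPx : IsAdmissibleAt hδ r Zx.1 Zx.2 Px)
    (hx : AlgPoints.baseChangeEquiv (algebraMap ℚ ℂ) 𝓜.M (𝓜.classifyingMap (specOver ℚ ℂ) Px) = x)
    {y : ComplexPoints ((Motives.baseChange ℚ ℂ).obj 𝓜'.M)} (Z₀' : siegelUpperHalfSpace g) (hZ₀' : θ Z₀' = Zx)
    (P₀' : PolarizedAbelianSchemeWithLevel g (N * m) δ (specOver ℚ ℂ).left)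
    (hP₀' : IsAdmissibleAt hδ r' Z₀'.1 Z₀'.2 P₀')
    (hy : AlgPoints.baseChangeEquiv (algebraMap ℚ ℂ) 𝓜'.M (𝓜'.classifyingMap (specOver ℚ ℂ) P₀') = y) :
    HeckeLinkedDeg 𝓜 𝓜' r' y x ν := by
  have hNm : 3 ≤ N * m := le_trans hN (Nat.le_mul_of_pos_right N hm)
  have hN0 : N ≠ 0 := by omega
  -- the integrality data of `γ` from (QA1), (QA2) at principal level, and the similitude (QA3)
  obtain ⟨-, -, hQA1, hQA2, -, ν', hν', hsim⟩ := id hQA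
  have hΛr := latticeOfGL_coe_eq_one_of_mem_principalLevelSubgroup_one hr
  have hΛr' := latticeOfGL_coe_eq_one_of_mem_principalLevelSubgroup_one hr'
  obtain ⟨G, hG⟩ := exists_map_intCastRingHom_eq_of_forall_mem_latticeOfGL_one
    (A := (γ : Matrix (Fin g ⊕ Fin g) (Fin g ⊕ Fin g) ℚ)) fun v hv => by
      rw [← hΛr]; exact hQA1 v (hΛr'.symm ▸ hv)
  obtain ⟨G', hG'⟩ := exists_map_intCastRingHom_eq_smul_of_forall_mem_latticeOfGL_one (m := m)
    (B := ((γ⁻¹ : GL (Fin g ⊕ Fin g) ℚ) : Matrix (Fin g ⊕ Fin g) (Fin g ⊕ Fin g) ℚ)) hN0 fun w hw => by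
      obtain ⟨v, hv, h⟩ := hQA2 w (hΛr.symm ▸ hw)
      exact ⟨v, hΛr' ▸ hv, h⟩
  refine ⟨hδ, hδ, θ, hθo, γ, hθ, r, hr, rfl, hQA, hsimν, fun Z P' hP' hP'y => ?_⟩
  -- `P′` and `P₀′` have the same class, so `P₀′` is admissible at `(Z, r′)` too; hence `Z = M′ • Z₀′`
  have hcls : 𝓜'.classifyingMap (specOver ℚ ℂ) P' = 𝓜'.classifyingMap (specOver ℚ ℂ) P₀' :=
    (AlgPoints.baseChangeEquiv (algebraMap ℚ ℂ) 𝓜'.M).injective (hP'y.trans hy.symm)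
  have hP₀'Z : IsAdmissibleAt hδ r' Z.1 Z.2 P₀' := isAdmissibleAt_of_classifyingMap_eq hδ 𝓜' hcls hP'
  obtain ⟨M', hM', hZM'⟩ := exists_siegelLevelGroup_smul_of_isAdmissibleAt hg hδ hNm hr' Z.2 Z₀'.2 P₀' hP₀'Z hP₀'
  -- `θ` carries the `Γ_δ(N·m)`-move to a `Γ_δ(N)`-move: `θ Z = M • Zₓ`
  obtain ⟨M, hM, hθM⟩ := exists_siegelLevelGroup_apply_gDHom_smul hδ.1 hG hG' hν'.ne' hsim θ hθ M' hM'
  have hθZ : θ Z = gDHom δ hδ.1 M • Zx := by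
    have h := hθM Z₀'
    rw [hZ₀'] at h
    rw [← h, ← hZM']
  -- `Pₓ` is admissible along the `Γ_δ(N)`-move at the principal `r`
  have hrel := (rel_iff_exists_smul hδ.1 (siegelLevelGroup_le_symplecticLatticeGroup δ N) Zx.2
    (gDHom δ hδ.1 M • Zx).2).2 ⟨M, hM, rfl⟩
  have hadm : IsAdmissibleAt hδ r (gDHom δ hδ.1 M • Zx).1 (gDHom δ hδ.1 M • Zx).2 Px :=
    isAdmissibleAt_of_rel hg hδ hN hr Zx.2 (gDHom δ hδ.1 M • Zx).2 hPx hrel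
  have key : ∀ (W : siegelUpperHalfSpace g) (hW : (W : Matrix (Fin g) (Fin g) ℂ) ∈ siegelUpperHalfSpace g),
      W = gDHom δ hδ.1 M • Zx → IsAdmissibleAt hδ r W.1 hW Px := by
    rintro W hW rfl
    exact hadm
  exact ⟨Px, key _ _ hθZ, hx⟩

/-- **(A4) WITH DEGREE, in the currency of the `ℓ`-adic producer (B3+ ★ `exists_ellAdicMove_integral`).**  For a real
symplectic `P` realising an INTEGRAL rational similitude `γ` on complex structures (`J(P⁻¹ • Z) = γ_ℝ J(Z) γ_ℝ⁻¹`) with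
`ℓ^K·γ⁻¹` integral, `ᵗγ E_δ γ = ℓ^K E_δ` and `γ ≡ 1 (mod N)` entrywise (the four clauses of ★ `exists_ellAdicMove_integral`
verbatim), a principal representative `r ∈ K_δ(1)` and `r′ = r·u` with `u ∈ K_δ(N)`, `x ∈ 𝓜_N(ℂ)` classified by `Pₓ` admissible
at `(Zₓ, r)` and `y ∈ 𝓜_{N·ℓ^K}(ℂ)` classified by `P₀′` admissible at `(P • Zₓ, r·u)`:
`HeckeLinkedDeg 𝓜 𝓜′ (r·u) y x (ℓ ^ K)` — the link of ★ `heckeLinked_at_ellAdicMove` REMEMBERING its degree `ℓᴷ = N′/N`.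
The lattice clauses (QA0)–(QA5) of ★ `QuotientAdapted` at `N′ = N·ℓ^K` are the entrywise integrality statements read on
`Λ_r = Λ_{r′} = ℤ^{2g}` (★ `latticeOfGL_coe_eq_one_of_mem_principalLevelSubgroup_one`), then `heckeLinkedDeg_at_lift`.
[cite: Milne2005ShimuraVarieties, §6 Thm. 6.11 p. 74, §5 p. 58] [cite: ShimuraIATAF1971, §3.2 Lemma 3.9]
[cite: Deligne1971TravauxShimura, 4.11–4.12 pp. 148–149] -/
theorem heckeLinkedDeg_at_ellAdicMove (hg : 0 < g) (hδ : IsPolarizationType δ) (hN : 3 ≤ N) {ℓ K : ℕ} (hℓ : 2 ≤ ℓ)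
    (𝓜 : SiegelFineModuliScheme g N δ) (𝓜' : SiegelFineModuliScheme g (N * ℓ ^ K) δ)
    [IsLocallyNoetherian (specOver ℚ ℂ).left]
    (P : Matrix.symplecticGroup (Fin g) ℝ) (γ : GL (Fin g ⊕ Fin g) ℚ)
    (hP : ∀ Z : siegelUpperHalfSpace g, jOfSiegel δ ((P⁻¹ • Z : siegelUpperHalfSpace g) : Matrix (Fin g) (Fin g) ℂ) =
      conjJ (Matrix.GeneralLinearGroup.map (algebraMap ℚ ℝ) γ) (jOfSiegel δ ((Z : siegelUpperHalfSpace g) : Matrix (Fin g) (Fin g) ℂ)))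
    (hγ : ∀ i j, ∃ z : ℤ, (γ : Matrix (Fin g ⊕ Fin g) (Fin g ⊕ Fin g) ℚ) i j = z)
    (hγ' : ∀ i j, ∃ z : ℤ,
      (ℓ : ℚ) ^ K * ((γ⁻¹ : GL (Fin g ⊕ Fin g) ℚ) : Matrix (Fin g ⊕ Fin g) (Fin g ⊕ Fin g) ℚ) i j = z)
    (hsim : (γ : Matrix (Fin g ⊕ Fin g) (Fin g ⊕ Fin g) ℚ)ᵀ * typeFormOver δ ℚ *
      (γ : Matrix (Fin g ⊕ Fin g) (Fin g ⊕ Fin g) ℚ) = ((ℓ : ℚ) ^ K) • typeFormOver δ ℚ)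
    (hγN : ∀ i j, ∃ z : ℤ, (γ : Matrix (Fin g ⊕ Fin g) (Fin g ⊕ Fin g) ℚ) i j -
      (1 : Matrix (Fin g ⊕ Fin g) (Fin g ⊕ Fin g) ℚ) i j = (N : ℚ) * z)
    {r u : gspFinAdelic δ} (hr : r ∈ principalLevelSubgroup δ 1) (hu : u ∈ principalLevelSubgroup δ N)
    {x : ComplexPoints ((Motives.baseChange ℚ ℂ).obj 𝓜.M)} (Zx : siegelUpperHalfSpace g)
    (Px : PolarizedAbelianSchemeWithLevel g N δ (specOver ℚ ℂ).left) (hPx : IsAdmissibleAt hδ r Zx.1 Zx.2 Px)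
    (hx : AlgPoints.baseChangeEquiv (algebraMap ℚ ℂ) 𝓜.M (𝓜.classifyingMap (specOver ℚ ℂ) Px) = x)
    {y : ComplexPoints ((Motives.baseChange ℚ ℂ).obj 𝓜'.M)}
    (P₀' : PolarizedAbelianSchemeWithLevel g (N * ℓ ^ K) δ (specOver ℚ ℂ).left)
    (hP₀' : IsAdmissibleAt hδ (r * u) (P • Zx : siegelUpperHalfSpace g).1 (P • Zx : siegelUpperHalfSpace g).2 P₀')
    (hy : AlgPoints.baseChangeEquiv (algebraMap ℚ ℂ) 𝓜'.M (𝓜'.classifyingMap (specOver ℚ ℂ) P₀') = y) :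
    HeckeLinkedDeg 𝓜 𝓜' (r * u) y x (ℓ ^ K) := by
  have hN0 : N ≠ 0 := by omega
  have hr' : r * u ∈ principalLevelSubgroup δ 1 :=
    Subgroup.mul_mem _ hr (principalLevelSubgroup_anti δ (one_dvd N) hu)
  have hNq : (N : ℚ) ≠ 0 := Nat.cast_ne_zero.2 hN0
  have hΛr := latticeOfGL_coe_eq_one_of_mem_principalLevelSubgroup_one hr
  have hΛr' := latticeOfGL_coe_eq_one_of_mem_principalLevelSubgroup_one hr'
  -- entrywise integrality, in the orientation of the tree's bridges
  have hγs : ∀ i j, ∃ z : ℤ, (z : ℚ) = (γ : Matrix (Fin g ⊕ Fin g) (Fin g ⊕ Fin g) ℚ) i j :=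
    fun i j => (hγ i j).imp fun z hz => hz.symm
  have hγ's : ∀ i j, ∃ z : ℤ, (z : ℚ) =
      ((ℓ : ℚ) ^ K • ((γ⁻¹ : GL (Fin g ⊕ Fin g) ℚ) : Matrix (Fin g ⊕ Fin g) (Fin g ⊕ Fin g) ℚ)) i j :=
    fun i j => (hγ' i j).imp fun z hz => by rw [Matrix.smul_apply, smul_eq_mul]; exact hz.symm
  have hAs : ∀ i j, ∃ z : ℤ, (z : ℚ) =
      ((N : ℚ)⁻¹ • ((γ : Matrix (Fin g ⊕ Fin g) (Fin g ⊕ Fin g) ℚ) - 1)) i j :=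
    fun i j => (hγN i j).imp fun z hz => by
      rw [Matrix.smul_apply, Matrix.sub_apply, smul_eq_mul, hz, ← mul_assoc, inv_mul_cancel₀ hNq, one_mul]
  have hQA : QuotientAdapted δ δ N (N * ℓ ^ K) r (r * u) γ := by
    refine ⟨Dvd.intro _ rfl, ⟨u, hu, rfl⟩, fun v hv => ?_, fun w hw => ?_, fun w hw => ?_,
      ⟨(ℓ : ℚ) ^ K, by positivity, hsim⟩⟩
    · rw [hΛr'] at hv
      rw [hΛr, mem_latticeOfGL_one_iff]
      exact forall_exists_int_eq_mulVec_of_forall_exists_int_eq hγs (mem_latticeOfGL_one_iff.1 hv)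
    · rw [hΛr] at hw
      refine ⟨((ℓ : ℚ) ^ K • ((γ⁻¹ : GL (Fin g ⊕ Fin g) ℚ) : Matrix (Fin g ⊕ Fin g) (Fin g ⊕ Fin g) ℚ)) *ᵥ w,
        ?_, ?_⟩
      · rw [hΛr', mem_latticeOfGL_one_iff]
        exact forall_exists_int_eq_mulVec_of_forall_exists_int_eq hγ's (mem_latticeOfGL_one_iff.1 hw)
      · rw [Matrix.smul_mulVec, smul_smul, Nat.cast_mul, Nat.cast_pow]
    · rw [hΛr] at hw
      refine ⟨((N : ℚ)⁻¹ • ((γ : Matrix (Fin g ⊕ Fin g) (Fin g ⊕ Fin g) ℚ) - 1)) *ᵥ w, ?_, ?_⟩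
      · rw [hΛr, mem_latticeOfGL_one_iff]
        exact forall_exists_int_eq_mulVec_of_forall_exists_int_eq hAs (mem_latticeOfGL_one_iff.1 hw)
      · rw [Matrix.smul_mulVec, smul_smul, mul_inv_cancel₀ hNq, one_smul, Matrix.sub_mulVec, Matrix.one_mulVec]
  have hθo : IsOpenMap fun Z : siegelUpperHalfSpace g => P⁻¹ • Z := isOpenMap_smul P⁻¹
  have hsimν : (γ : Matrix (Fin g ⊕ Fin g) (Fin g ⊕ Fin g) ℚ)ᵀ * typeFormOver δ ℚ *
      (γ : Matrix (Fin g ⊕ Fin g) (Fin g ⊕ Fin g) ℚ) = ((ℓ ^ K : ℕ) : ℚ) • typeFormOver δ ℚ := by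
    rw [Nat.cast_pow]; exact hsim
  exact heckeLinkedDeg_at_lift hg hδ hN (pow_pos (by omega) K) 𝓜 𝓜' (fun Z => P⁻¹ • Z) hθo γ hP hr hr' hQA (ℓ ^ K) hsimν
    Zx Px hPx hx (P • Zx) (inv_smul_smul P Zx) P₀' hP₀' hy

/-- (A4)′ WITH DEGREE — `heckeLinkedDeg_at_ellAdicMove` with a level VARIABLE `N′ = N·ℓᴷ` (tower typing: `SiegelLevel.N` is
never syntactically a product; shape of ★ `EquidimSocketThickLinkedLift.heckeLinked_at_ellAdicMove'`).
[cite: Milne2005ShimuraVarieties, §6 Thm. 6.11 pp. 74–75] -/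
theorem heckeLinkedDeg_at_ellAdicMove' (hg : 0 < g) (hδ : IsPolarizationType δ) (hN : 3 ≤ N) {ℓ K : ℕ} (hℓ : 2 ≤ ℓ)
    (N' : ℕ) (hN' : N' = N * ℓ ^ K)
    (𝓜 : SiegelFineModuliScheme g N δ) (𝓜' : SiegelFineModuliScheme g N' δ)
    [IsLocallyNoetherian (specOver ℚ ℂ).left]
    (P : Matrix.symplecticGroup (Fin g) ℝ) (γ : GL (Fin g ⊕ Fin g) ℚ)
    (hP : ∀ Z : siegelUpperHalfSpace g, jOfSiegel δ ((P⁻¹ • Z : siegelUpperHalfSpace g) : Matrix (Fin g) (Fin g) ℂ) =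
      conjJ (Matrix.GeneralLinearGroup.map (algebraMap ℚ ℝ) γ) (jOfSiegel δ ((Z : siegelUpperHalfSpace g) : Matrix (Fin g) (Fin g) ℂ)))
    (hγ : ∀ i j, ∃ z : ℤ, (γ : Matrix (Fin g ⊕ Fin g) (Fin g ⊕ Fin g) ℚ) i j = z)
    (hγ' : ∀ i j, ∃ z : ℤ,
      (ℓ : ℚ) ^ K * ((γ⁻¹ : GL (Fin g ⊕ Fin g) ℚ) : Matrix (Fin g ⊕ Fin g) (Fin g ⊕ Fin g) ℚ) i j = z)
    (hsim : (γ : Matrix (Fin g ⊕ Fin g) (Fin g ⊕ Fin g) ℚ)ᵀ * typeFormOver δ ℚ *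
      (γ : Matrix (Fin g ⊕ Fin g) (Fin g ⊕ Fin g) ℚ) = ((ℓ : ℚ) ^ K) • typeFormOver δ ℚ)
    (hγN : ∀ i j, ∃ z : ℤ, (γ : Matrix (Fin g ⊕ Fin g) (Fin g ⊕ Fin g) ℚ) i j -
      (1 : Matrix (Fin g ⊕ Fin g) (Fin g ⊕ Fin g) ℚ) i j = (N : ℚ) * z)
    {r u : gspFinAdelic δ} (hr : r ∈ principalLevelSubgroup δ 1) (hu : u ∈ principalLevelSubgroup δ N)
    {x : ComplexPoints ((Motives.baseChange ℚ ℂ).obj 𝓜.M)} (Zx : siegelUpperHalfSpace g)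
    (Px : PolarizedAbelianSchemeWithLevel g N δ (specOver ℚ ℂ).left) (hPx : IsAdmissibleAt hδ r Zx.1 Zx.2 Px)
    (hx : AlgPoints.baseChangeEquiv (algebraMap ℚ ℂ) 𝓜.M (𝓜.classifyingMap (specOver ℚ ℂ) Px) = x)
    {y : ComplexPoints ((Motives.baseChange ℚ ℂ).obj 𝓜'.M)}
    (P₀' : PolarizedAbelianSchemeWithLevel g N' δ (specOver ℚ ℂ).left)
    (hP₀' : IsAdmissibleAt hδ (r * u) (P • Zx : siegelUpperHalfSpace g).1 (P • Zx : siegelUpperHalfSpace g).2 P₀')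
    (hy : AlgPoints.baseChangeEquiv (algebraMap ℚ ℂ) 𝓜'.M (𝓜'.classifyingMap (specOver ℚ ℂ) P₀') = y) :
    HeckeLinkedDeg 𝓜 𝓜' (r * u) y x (ℓ ^ K) := by
  subst hN'
  exact heckeLinkedDeg_at_ellAdicMove hg hδ hN hℓ 𝓜 𝓜' P γ hP hγ hγ' hsim hγN hr hu Zx Px hPx hx P₀' hP₀' hy

/-- **(A4) WITH DEGREE for the glue, reading the lift through its level-`N` shadow.**  ★
`exists_heckeLinked_at_ellAdicMove_of_changeLevel` with the degree exported: the caller hands the admissibility of the SHADOW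
`P₀′.changeLevel N (ℓ^K)` at `(P • Zₓ, r)`; the representative `r·u`, `u ∈ K_δ(N)`, at which `P₀′` itself is admissible is
produced by ★ L4 `exists_isAdmissibleAt` + ★ (U) `IsAdmissibleAt.exists_mul_mem_principalLevelSubgroup_of_changeLevel`, and
`HeckeLinkedDeg 𝓜 𝓜′ (r·u) y x (ℓ ^ K)` holds there. [cite: Milne2005ShimuraVarieties, §5 Lemma 5.13 p. 57, §6 Thm. 6.11 pp. 74–75]
[cite: ShimuraIATAF1971, §3.2 Lemma 3.9] -/
theorem exists_heckeLinkedDeg_at_ellAdicMove_of_changeLevel (hg : 0 < g) (hδ : IsPolarizationType δ) (hN : 3 ≤ N)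
    {ℓ K : ℕ} (hℓ : 2 ≤ ℓ)
    (𝓜 : SiegelFineModuliScheme g N δ) (𝓜' : SiegelFineModuliScheme g (N * ℓ ^ K) δ)
    [IsLocallyNoetherian (specOver ℚ ℂ).left]
    (P : Matrix.symplecticGroup (Fin g) ℝ) (γ : GL (Fin g ⊕ Fin g) ℚ)
    (hP : ∀ Z : siegelUpperHalfSpace g, jOfSiegel δ ((P⁻¹ • Z : siegelUpperHalfSpace g) : Matrix (Fin g) (Fin g) ℂ) =
      conjJ (Matrix.GeneralLinearGroup.map (algebraMap ℚ ℝ) γ) (jOfSiegel δ ((Z : siegelUpperHalfSpace g) : Matrix (Fin g) (Fin g) ℂ)))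
    (hγ : ∀ i j, ∃ z : ℤ, (γ : Matrix (Fin g ⊕ Fin g) (Fin g ⊕ Fin g) ℚ) i j = z)
    (hγ' : ∀ i j, ∃ z : ℤ,
      (ℓ : ℚ) ^ K * ((γ⁻¹ : GL (Fin g ⊕ Fin g) ℚ) : Matrix (Fin g ⊕ Fin g) (Fin g ⊕ Fin g) ℚ) i j = z)
    (hsim : (γ : Matrix (Fin g ⊕ Fin g) (Fin g ⊕ Fin g) ℚ)ᵀ * typeFormOver δ ℚ *
      (γ : Matrix (Fin g ⊕ Fin g) (Fin g ⊕ Fin g) ℚ) = ((ℓ : ℚ) ^ K) • typeFormOver δ ℚ)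
    (hγN : ∀ i j, ∃ z : ℤ, (γ : Matrix (Fin g ⊕ Fin g) (Fin g ⊕ Fin g) ℚ) i j -
      (1 : Matrix (Fin g ⊕ Fin g) (Fin g ⊕ Fin g) ℚ) i j = (N : ℚ) * z)
    {r : gspFinAdelic δ} (hr : r ∈ principalLevelSubgroup δ 1)
    {x : ComplexPoints ((Motives.baseChange ℚ ℂ).obj 𝓜.M)} (Zx : siegelUpperHalfSpace g)
    (Px : PolarizedAbelianSchemeWithLevel g N δ (specOver ℚ ℂ).left) (hPx : IsAdmissibleAt hδ r Zx.1 Zx.2 Px)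
    (hx : AlgPoints.baseChangeEquiv (algebraMap ℚ ℂ) 𝓜.M (𝓜.classifyingMap (specOver ℚ ℂ) Px) = x)
    {y : ComplexPoints ((Motives.baseChange ℚ ℂ).obj 𝓜'.M)}
    (P₀' : PolarizedAbelianSchemeWithLevel g (N * ℓ ^ K) δ (specOver ℚ ℂ).left) (hNm : N * ℓ ^ K ≠ 0)
    (h : IsAdmissibleAt hδ r (P • Zx : siegelUpperHalfSpace g).1 (P • Zx : siegelUpperHalfSpace g).2
      (P₀'.changeLevel N (ℓ ^ K) rfl hNm))
    (hy : AlgPoints.baseChangeEquiv (algebraMap ℚ ℂ) 𝓜'.M (𝓜'.classifyingMap (specOver ℚ ℂ) P₀') = y) :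
    ∃ u ∈ principalLevelSubgroup δ N, HeckeLinkedDeg 𝓜 𝓜' (r * u) y x (ℓ ^ K) := by
  -- some principal reading of `P₀′` itself (★ L4), then (U) aligns it with the shadow's reading at `(P • Zₓ, r)`
  obtain ⟨-, -, r₀, -, -, hr₀, -, -, Z₀, hZ₀, h₀⟩ := exists_isAdmissibleAt hδ hg hNm P₀'
  obtain ⟨u, hu, hP₀'⟩ := h₀.exists_mul_mem_principalLevelSubgroup_of_changeLevel hg hN hr hr₀ (ℓ ^ K) rfl hNm h
  exact ⟨u, hu, heckeLinkedDeg_at_ellAdicMove hg hδ hN hℓ 𝓜 𝓜' P γ hP hγ hγ' hsim hγN hr hu Zx Px hPx hx P₀' hP₀' hy⟩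

end Summit.HodgeConjecture.HodgeConjecture.Theorems.EquidimHeckeLinkDeg

end
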